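import Mathlib.NumberTheory.NumberField.Cyclotomic.Basic
import Mathlib.RingTheory.DedekindDomain.Different
import Mathlib.NumberTheory.NumberField.CMField
import Literature.NumberTheory.ComplexMultiplication.CMTorusPolarizationType
import HarnessLib

/-!
# Weil-type family coverage — the different of `ℚ(ζₙ)` is `(Φₙ′(ζ))`, and the census generator
# `ξ = ζ^k/Φₙ′(ζ)` of `𝔡⁻¹` is of PRINCIPAL type on the unit lattice (`CMTypeLattice.IsOfType 1 ξ ⊤`)

research route conditional on HC_CM; not a corollary; Q11.4-sentence-2 already refuted in dim ≥ 3.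

Ring 2, WEIL-TYPE FAMILY-COVERAGE CENSUS (`HOME/WEIL-FAMILY-COVERAGE.md` `## b01`, blocks b01.23 (A) Step 2
«`(ξ₀) = 𝔇_L⁻¹`, `ξ₀ = ζ^{g−1}/Φ′_M(ζ)` purely imaginary generator» and b01.28 THEOREM L (L-crit) «`E_ξ` is
integral and unimodular on `𝔞` ⟺ `(ξ) = (𝔞𝔞̄𝔇_L)⁻¹`», owner ring2-b01), part 6′ of the `Ring2WeilCoverage*`
series.  Part 2 (`Ring2WeilCoverageCMUnitSignature`) proved the unit-signature criterion for Shimura's divisors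
`X_ζ` of type `(K; Φ; 𝔣₀)` on the principal CM tori `ℂ^Φ/D(𝔪)` (`CMTypeLattice.IsOfType 𝔪 ζ 𝔣₀` =
«`𝔬𝔣₀ = ζ𝔡𝔪𝔪^ρ`», `𝔡 = differentIdeal ℤ (𝓞 K)`) starting from ONE skew `ζ₀` of the given type; this file
supplies that `ζ₀` for the census's case — `K = ℚ(ζₙ)`, the unit lattice `𝔪 = 𝔬 = ℤ[ζₙ]`, the PRINCIPAL type
`𝔣₀ = 𝔬₀` — in the tree's vocabulary:

* §1 **`differentIdeal_eq_span_aeval_derivative_cyclotomic`: `𝔡_{ℚ(ζₙ)/ℚ} = (Φₙ′(ζ))`** for EVERY `n`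
  (Mathlib: `ℤ[ζ] = 𝓞` — `IsCyclotomicExtension.Rat.adjoin_singleton_eq_top` — so the conductor of `ℤ[ζ]` is
  `(1)` and `conductor_mul_differentIdeal` («`(f′(α)) = 𝔣·𝔇`») gives `𝔇 = (Φₙ′(ζ))`, `minpoly_ℤ ζ = Φₙ`);
  as fractional ideals `coe_differentIdeal_eq_spanSingleton`.
* §2 the census element `ξ_k := ζ^k·Φₙ′(ζ)⁻¹` (no `def`: written out): `Φₙ′(ζ) ≠ 0` (separability), `ξ_k ≠ 0`,
  **`spanSingleton_xi_mul_differentIdeal`: `(ξ_k)·𝔡 = (1)`** (`ζ` is a unit of `𝓞`), hence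
  **`isOfType_one_xi_top`: `CMTypeLattice.IsOfType 1 ξ_k ⊤`** — on `ℂ^Φ/Φ(𝔬)` the divisor `X_{ξ_k}` (when
  `Φ`-positive) has `φ_X` = the `𝔬`-multiplication: a PRINCIPAL `ι`-compatible polarisation
  ([Shimura 1998 §14.3 Prop. 4]; the hypothesis `hT` of part 2's `exists_pos_isOfType_iff_exists_units`).
* §3 `embedding_aeval_derivative_cyclotomic` / `embedding_xi`: an embedding `σ : K → ℂ` sends `ξ_k` to
  `σ(ζ)^k·Φₙ′(σ ζ)⁻¹` computed with the complex cyclotomic polynomial (the input of part 6's sign computation).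

HONEST FRAMING: ideal-theoretic bookkeeping in `ℚ(ζₙ)` on Mathlib's cyclotomic integers; which `k` makes `ξ_k`
skew (`k = g − 1`, `2g = φ(n)`) and the signs of `Im σ(ξ_k)` are parts 6/7; nothing here is a statement about
Hodge classes, `W_K` or HC; `HC_CM` is used nowhere.  No `def`, no named fact, no `sorry`.

References: [cite: Shimura1998, §14.3 Prop. 4, pp. 103–104] (type `(K; Φ; 𝔣₀)`); the different of a monogenic
order [cite: NeukirchANT1999, Ch. III (2.4) Proposition] with `𝓞_{ℚ(ζₙ)} = ℤ[ζₙ]` [cite: NeukirchANT1999, Ch. I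
(10.2) Proposition]; census b01.28 (L-crit) = [van Wamelen, Math. Comp. 68 (1999) Thm 3] (P-b01.28-4, located by
lit-reduction g91; not re-read here).
-/

noncomputable section

open Polynomial NumberField
open scoped nonZeroDivisors

namespace Summit.HodgeConjecture.Ring2WeilCoverage.CyclotomicDifferent

open Literature.NumberTheory.ComplexMultiplication

variable {K : Type} [Field K] [NumberField K] {n : ℕ} [NeZero n] {ζ : K}

/-! ### §1 The different of a cyclotomic field -/

/-- The minimal polynomial over `ℤ` of `ζ ∈ 𝓞 K` (a primitive `n`-th root of unity of `K = ℚ(ζₙ)`) is `Φₙ`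
(Mathlib `cyclotomic_eq_minpoly`, transported to `𝓞 K`).
research route conditional on HC_CM; not a corollary; Q11.4-sentence-2 already refuted in dim ≥ 3. [folklore] -/
theorem minpoly_toInteger_eq_cyclotomic (hζ : IsPrimitiveRoot ζ n) :
    minpoly ℤ hζ.toInteger = cyclotomic n ℤ := by
  have h1 : minpoly ℤ hζ.toInteger = minpoly ℤ (algebraMap (𝓞 K) K hζ.toInteger) :=
    (minpoly.algebraMap_eq (A := ℤ) (B := 𝓞 K) (B' := K) RingOfIntegers.coe_injective
      hζ.toInteger).symm
  rw [h1]
  exact (cyclotomic_eq_minpoly hζ (NeZero.pos n)).symm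

/-- **THE DIFFERENT OF `ℚ(ζₙ)`: `𝔡 = (Φₙ′(ζ))`** (every `n`; `ℤ[ζ] = 𝓞` so the conductor is `(1)` and
`(f′(ζ)) = 𝔣·𝔇 = 𝔇`).
research route conditional on HC_CM; not a corollary; Q11.4-sentence-2 already refuted in dim ≥ 3. [cite: NeukirchANT1999, Ch. III (2.4) Proposition] -/
theorem differentIdeal_eq_span_aeval_derivative_cyclotomic [IsCyclotomicExtension {n} ℚ K]
    (hζ : IsPrimitiveRoot ζ n) :
    differentIdeal ℤ (𝓞 K) = Ideal.span {aeval hζ.toInteger (derivative (cyclotomic n ℤ))} := by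
  classical
  have htop : Algebra.adjoin ℚ {algebraMap (𝓞 K) K hζ.toInteger} = ⊤ :=
    IsCyclotomicExtension.adjoin_primitive_root_eq_top hζ
  have hcond : conductor ℤ hζ.toInteger = ⊤ :=
    conductor_eq_top_of_adjoin_eq_top (IsCyclotomicExtension.Rat.adjoin_singleton_eq_top hζ)
  have hD := conductor_mul_differentIdeal ℤ ℚ K hζ.toInteger htop
  rw [hcond, Ideal.top_mul, minpoly_toInteger_eq_cyclotomic hζ] at hD
  exact hD

/-- `(Φₙ′(ζ) : K)` computed from the integer `Φₙ′(ζ) ∈ 𝓞 K`.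
research route conditional on HC_CM; not a corollary; Q11.4-sentence-2 already refuted in dim ≥ 3. [folklore] -/
theorem coe_aeval_toInteger_derivative_cyclotomic (hζ : IsPrimitiveRoot ζ n) :
    ((aeval hζ.toInteger (derivative (cyclotomic n ℤ)) : 𝓞 K) : K) =
      aeval ζ (derivative (cyclotomic n ℚ)) := by
  have h1 : ((aeval hζ.toInteger (derivative (cyclotomic n ℤ)) : 𝓞 K) : K) =
      aeval (ζ : K) (derivative (cyclotomic n ℤ)) := by
    rw [show ((aeval hζ.toInteger (derivative (cyclotomic n ℤ)) : 𝓞 K) : K) =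
      algebraMap (𝓞 K) K (aeval hζ.toInteger (derivative (cyclotomic n ℤ))) from rfl,
      ← aeval_algebraMap_apply]
    rfl
  rw [h1, aeval_eq_aeval_map (φ := Int.castRingHom ℚ) (Subsingleton.elim _ _), ← derivative_map,
    map_cyclotomic_int]

/-- **`𝔡 = (Φₙ′(ζ))` as fractional ideals of `K = ℚ(ζₙ)`.**
research route conditional on HC_CM; not a corollary; Q11.4-sentence-2 already refuted in dim ≥ 3. [cite: NeukirchANT1999, Ch. III (2.4) Proposition] -/
theorem coe_differentIdeal_eq_spanSingleton [IsCyclotomicExtension {n} ℚ K] (hζ : IsPrimitiveRoot ζ n) :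
    ((differentIdeal ℤ (𝓞 K) : Ideal (𝓞 K)) : FractionalIdeal (𝓞 K)⁰ K) =
      FractionalIdeal.spanSingleton (𝓞 K)⁰ (aeval ζ (derivative (cyclotomic n ℚ))) := by
  rw [differentIdeal_eq_span_aeval_derivative_cyclotomic hζ, FractionalIdeal.coeIdeal_span_singleton,
    ← coe_aeval_toInteger_derivative_cyclotomic hζ]

/-! ### §2 The census generator `ξ_k = ζ^k/Φₙ′(ζ)` of `𝔡⁻¹`, and its principal type -/

/-- `Φₙ′(ζ) ≠ 0` (`Φₙ` is separable over `ℚ`).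
research route conditional on HC_CM; not a corollary; Q11.4-sentence-2 already refuted in dim ≥ 3. [folklore] -/
theorem aeval_derivative_cyclotomic_ne_zero (hζ : IsPrimitiveRoot ζ n) :
    aeval ζ (derivative (cyclotomic n ℚ)) ≠ 0 := by
  refine Polynomial.Separable.aeval_derivative_ne_zero (cyclotomic.irreducible_rat (NeZero.pos n)).separable ?_
  rw [aeval_def, eval₂_eq_eval_map, map_cyclotomic]
  exact (hζ.isRoot_cyclotomic (NeZero.pos n))

/-- The census element `ξ_k = ζ^k·Φₙ′(ζ)⁻¹` is non-zero.
research route conditional on HC_CM; not a corollary; Q11.4-sentence-2 already refuted in dim ≥ 3. [folklore] -/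
theorem xi_ne_zero (hζ : IsPrimitiveRoot ζ n) (k : ℕ) :
    ζ ^ k * (aeval ζ (derivative (cyclotomic n ℚ)))⁻¹ ≠ 0 :=
  mul_ne_zero (pow_ne_zero _ (hζ.ne_zero (NeZero.ne n)))
    (inv_ne_zero (aeval_derivative_cyclotomic_ne_zero hζ))

/-- **`(ξ_k)·𝔡 = (1)`**: `ξ_k = ζ^k/Φₙ′(ζ)` generates `𝔡⁻¹` (`ζ` is a unit of `𝓞 = ℤ[ζ]`).  Census b01.23 (A)
Step 2 «`(ξ₀) = 𝔇_L⁻¹`».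
research route conditional on HC_CM; not a corollary; Q11.4-sentence-2 already refuted in dim ≥ 3. [folklore] -/
theorem spanSingleton_xi_mul_differentIdeal [IsCyclotomicExtension {n} ℚ K] (hζ : IsPrimitiveRoot ζ n)
    (k : ℕ) :
    FractionalIdeal.spanSingleton (𝓞 K)⁰ (ζ ^ k * (aeval ζ (derivative (cyclotomic n ℚ)))⁻¹) *
      ((differentIdeal ℤ (𝓞 K) : Ideal (𝓞 K)) : FractionalIdeal (𝓞 K)⁰ K) = 1 := by
  rw [coe_differentIdeal_eq_spanSingleton hζ, FractionalIdeal.spanSingleton_mul_spanSingleton, mul_assoc,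
    inv_mul_cancel₀ (aeval_derivative_cyclotomic_ne_zero hζ), mul_one]
  have hu : IsUnit (hζ.toInteger ^ k) := (hζ.toInteger_isPrimitiveRoot.isUnit (NeZero.ne n)).pow k
  have h1 : (ζ ^ k : K) = (((hζ.toInteger ^ k : 𝓞 K)) : K) := by simp [IsPrimitiveRoot.toInteger]
  rw [h1, show (((hζ.toInteger ^ k : 𝓞 K)) : K) = algebraMap (𝓞 K) K (hζ.toInteger ^ k) from rfl,
    ← FractionalIdeal.coeIdeal_span_singleton, Ideal.span_singleton_eq_top.mpr hu,
    FractionalIdeal.coeIdeal_top]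

/-- **THE CENSUS GENERATOR IS OF PRINCIPAL TYPE ON THE UNIT LATTICE: `CMTypeLattice.IsOfType 1 ξ_k ⊤`**, i.e.
`𝔬·𝔬₀ = ξ_k·𝔡·𝔬·𝔬^ρ` for `K = ℚ(ζₙ)` a CM field (`n > 2`): the divisor `X_{ξ_k}` on the principal CM torus
`ℂ^Φ/Φ(𝔬)` — when `ξ_k` is skew and `Φ`-positive — has `φ_X` = the `𝔬`-multiplication, a PRINCIPAL
polarisation ([Sh98 §14.3 Prop. 4]); this is the hypothesis `hT` of part 2's unit-signature criterion
`Ring2WeilCoverage.CMUnitSignature.exists_pos_isOfType_iff_exists_units` in the census's case `𝔪 = 𝔬`,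
`𝔣₀ = 𝔬₀`.
research route conditional on HC_CM; not a corollary; Q11.4-sentence-2 already refuted in dim ≥ 3. [cite: Shimura1998, §14.3 Prop. 4, pp. 103–104] -/
theorem isOfType_one_xi_top [IsCyclotomicExtension {n} ℚ K] [IsCMField K] (hζ : IsPrimitiveRoot ζ n)
    (k : ℕ) :
    CMTypeLattice.IsOfType (1 : (FractionalIdeal (𝓞 K)⁰ K)ˣ)
      (ζ ^ k * (aeval ζ (derivative (cyclotomic n ℚ)))⁻¹) ⊤ := by
  rw [CMTypeLattice.isOfType_iff, Ideal.map_top, FractionalIdeal.coeIdeal_top, CMTypeLattice.conjIdeal_one,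
    Units.val_one, mul_one, mul_one, spanSingleton_xi_mul_differentIdeal hζ k]

/-! ### §3 Embeddings evaluate `ξ_k` through the complex cyclotomic polynomial -/

omit [NeZero n] in
/-- An embedding `σ : K → ℂ` evaluates `Φₙ′(ζ)` to `Φₙ′(σ ζ)` (complex cyclotomic polynomial).
research route conditional on HC_CM; not a corollary; Q11.4-sentence-2 already refuted in dim ≥ 3. [folklore] -/
theorem embedding_aeval_derivative_cyclotomic (σ : K →+* ℂ) :
    σ (aeval ζ (derivative (cyclotomic n ℚ))) = eval (σ ζ) (derivative (cyclotomic n ℂ)) := by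
  rw [map_aeval_eq_aeval_map (φ := RingHom.id ℚ) (ψ := σ) (Subsingleton.elim _ _), Polynomial.map_id,
    aeval_def, eval₂_eq_eval_map, ← derivative_map, map_cyclotomic]

omit [NeZero n] in
/-- **`σ(ξ_k) = σ(ζ)^k·Φₙ′(σ ζ)⁻¹`** for an embedding `σ : K → ℂ`.
research route conditional on HC_CM; not a corollary; Q11.4-sentence-2 already refuted in dim ≥ 3. [folklore] -/
theorem embedding_xi (σ : K →+* ℂ) (k : ℕ) :
    σ (ζ ^ k * (aeval ζ (derivative (cyclotomic n ℚ)))⁻¹) =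
      (σ ζ) ^ k * (eval (σ ζ) (derivative (cyclotomic n ℂ)))⁻¹ := by
  rw [map_mul, map_pow, map_inv₀, embedding_aeval_derivative_cyclotomic]

end Summit.HodgeConjecture.Ring2WeilCoverage.CyclotomicDifferent

end
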